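import Literature.Geometry.Lorentzian.TimeCones
import HarnessLib

/-!
# A vector whose scalar product with every future causal vector is positive is past timelike
# (the gradient of a time function; O'Neill 1983, Ch. 5, Lemma 5.26 ff.)

For a time-oriented Lorentzian metric `(g, τ)` on `M` and a tangent vector `u ∈ T_xM`: **if
`g_x(u, v) > 0` for every future-directed causal `v`, then `u` is timelike and past-directed**
(`-u` is future-directed; `TimeOrientation.isTimelike_of_forall_val_pos`,
`TimeOrientation.isFutureDirected_neg_of_forall_val_pos`). This is the statement "the gradient of
a time function is past-directed timelike" (a function `f` with `df(v) > 0` on the future causal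
cone has `grad f = ♯df` with `g(grad f, v) = df(v) > 0`; Hawking–Ellis 1973, §6.4, p. 198;
O'Neill 1983, Ch. 5, Lemma 5.26 and Ch. 14, p. 403), and gives the spacelike character of the
level sets of a time function together with their future unit normal `-grad f / |grad f|`
(`MetricCoord.sliceNormal`, `CoordSliceNormal.lean`).

Proof (O'Neill, Lemma 5.26: `T^⊥` is spacelike, and the structure field
`LorentzianMetric.pos_of_orthogonal`). `u ≠ 0` since `g(u, T) > 0`. If `g(u, u) > 0`, the vector
`w = g(u,u) T - g(T,u) u` is orthogonal to `u`, timelike and future-directed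
(`g(w, w) = g(u,u)(g(u,u) g(T,T) - g(T,u)²) < 0`, `g(T, w) = g(u,u) g(T,T) - g(T,u)² < 0`), yet
`g(u, w) = 0` — contradiction. If `g(u, u) = 0`, then `u` is causal, hence `u` or `-u` is
future-directed (`g(T, u) ≠ 0` for a nonzero null vector, again by Lemma 5.26), and
`g(u, ±u) = ±g(u, u) = 0` is not positive — contradiction. So `g(u, u) < 0`; and `g(T, -u) < 0`
from `g(u, T) > 0` makes `-u` future-directed.

Everything is proved; no definitions, no named facts (D-0026).

## References

* B. O'Neill, *Semi-Riemannian geometry with applications to relativity*, Academic Press 1983,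
  Ch. 5, Lemma 5.26 (p. 141), p. 145; Ch. 14, p. 403. [ONeillSemiRiemannian1983]
* S. W. Hawking, G. F. R. Ellis, *The large scale structure of space-time*, CUP 1973, §6.4,
  p. 198 (time functions). [HawkingEllis1973CUP]
-/

noncomputable section

open Set Filter
open scoped Topology Manifold ContDiff

namespace Literature.Geometry.Lorentzian

variable {E : Type*} [NormedAddCommGroup E] [NormedSpace ℝ E] {H : Type*} [TopologicalSpace H]
  {I : ModelWithCorners ℝ E H} {n : ℕ∞ω} {M : Type*} [TopologicalSpace M] [ChartedSpace H M]
  [IsManifold I ∞ M]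

namespace TimeOrientation

variable {g : LorentzianMetric I n M} (τ : TimeOrientation g) {x : M}

/-- **A vector pairing positively with every future causal vector is timelike.** If
`g_x(u, v) > 0` for all future-directed causal `v ∈ T_xM`, then `g_x(u, u) < 0`. O'Neill 1983,
Ch. 5, Lemma 5.26 ff. (see the module docstring for the proof).
[cite: ONeillSemiRiemannian1983, Ch. 5, Lemma 5.26 (p. 141)] -/
theorem isTimelike_of_forall_val_pos {u : TangentSpace I x}
    (hu : ∀ v : TangentSpace I x, τ.IsFutureDirected v → 0 < g.val x u v) : g.IsTimelike u := by
  set T := τ.vectorField x with hT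
  have hTT : g.val x T T < 0 := τ.isTimelike x
  have hTfut : τ.IsFutureDirected T := τ.isFutureDirected_vectorField x
  have huT : 0 < g.val x u T := hu T hTfut
  have hTu : 0 < g.val x T u := by rw [g.symm]; exact huT
  have hu0 : u ≠ 0 := fun h ↦ by
    rw [h, map_zero] at huT
    exact lt_irrefl _ huT
  -- exclude `g(u,u) > 0` and `g(u,u) = 0`
  by_contra hnot
  have hge : 0 ≤ g.val x u u := not_lt.1 hnot
  rcases hge.eq_or_lt with h0 | hpos
  · -- `u` null and nonzero: `u` or `-u` is future causal, pairing to `±g(u,u) = 0`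
    have hcausal : g.IsCausal u := ⟨h0.symm.le, hu0⟩
    rcases lt_trichotomy (g.val x T u) 0 with hlt | heq | hgt
    · have hfut : τ.IsFutureDirected u := ⟨hcausal, hlt⟩
      have h := hu u hfut
      rw [← h0] at h
      exact lt_irrefl _ h
    · exact absurd heq hTu.ne'
    · -- `g(T,u) > 0`: then `-u` is future-directed
      have hcausal' : g.IsCausal (-u) := by
        refine ⟨?_, neg_ne_zero.2 hu0⟩
        simp only [map_neg, neg_apply, neg_neg]
        exact h0.symm.le
      have hfut : τ.IsFutureDirected (-u) := by
        refine ⟨hcausal', ?_⟩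
        show g.val x T (-u) < 0
        rw [map_neg]
        linarith
      have h := hu (-u) hfut
      rw [map_neg, ← h0, neg_zero] at h
      exact lt_irrefl _ h
  · -- `u` spacelike: `w = g(u,u) T - g(T,u) u ⊥ u` is future timelike with `g(u, w) = 0`
    set a := g.val x u u with ha
    set b := g.val x T u with hb
    set w : TangentSpace I x := a • T - b • u with hw
    have huu : g.val x u T = b := by rw [hb, g.symm]
    have huw : g.val x u w = 0 := by
      simp only [hw, map_sub, map_smul, smul_eq_mul, huu]
      ring
    have hww : g.val x w w = a * (a * g.val x T T - b ^ 2) := by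
      simp only [hw, map_sub, map_smul, smul_eq_mul, sub_apply, FunLike.coe_smul, Pi.smul_apply,
        huu]
      ring
    have hTw : g.val x T w = a * g.val x T T - b ^ 2 := by
      simp only [hw, map_sub, map_smul, smul_eq_mul]
      ring
    have hneg : a * g.val x T T - b ^ 2 < 0 := by
      have h1 : a * g.val x T T < 0 := mul_neg_of_pos_of_neg hpos hTT
      nlinarith [sq_nonneg b]
    have hwt : g.IsTimelike w := by
      show g.val x w w < 0
      rw [hww]
      exact mul_neg_of_pos_of_neg hpos hneg
    have hwfut : τ.IsFutureDirected w := by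
      refine ⟨⟨hwt.le, fun h ↦ ?_⟩, ?_⟩
      · have h' : g.val x w w < 0 := hwt
        rw [h, map_zero] at h'
        exact lt_irrefl _ h'
      · show g.val x T w < 0
        rw [hTw]
        exact hneg
    have h := hu w hwfut
    rw [huw] at h
    exact lt_irrefl _ h

/-- **The gradient of a time function is past-directed**: if `g_x(u, v) > 0` for all
future-directed causal `v`, then `-u` is future-directed timelike. O'Neill 1983, Ch. 5, p. 145;
Hawking–Ellis 1973, §6.4, p. 198. [cite: ONeillSemiRiemannian1983, Ch. 5, Lemma 5.26 (p. 141) and p. 145] -/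
theorem isFutureDirected_neg_of_forall_val_pos {u : TangentSpace I x}
    (hu : ∀ v : TangentSpace I x, τ.IsFutureDirected v → 0 < g.val x u v) :
    g.IsTimelike (-u) ∧ τ.IsFutureDirected (-u) := by
  have ht : g.IsTimelike u := τ.isTimelike_of_forall_val_pos hu
  have hu0 : u ≠ 0 := fun h ↦ by
    have h' : g.val x u u < 0 := ht
    rw [h, map_zero] at h'
    exact lt_irrefl _ h'
  have hneg : g.IsTimelike (-u) := by
    show g.val x (-u) (-u) < 0
    simp only [map_neg, neg_apply, neg_neg]
    exact ht
  refine ⟨hneg, ⟨hneg.le, neg_ne_zero.2 hu0⟩, ?_⟩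
  show g.val x (τ.vectorField x) (-u) < 0
  rw [map_neg, g.symm]
  have h := hu (τ.vectorField x) (τ.isFutureDirected_vectorField x)
  linarith

end TimeOrientation

end Literature.Geometry.Lorentzian

end
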